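import Summits.QuantumFields.YangMills.Theorems.BalabanUVNodesK0Stub3RunwiseSuppliers

/-!
# K0⁷ — V19's BOX SOCKET 3ᴬ′ FROM THE K3∕N22 KERNEL LETTERS ALONE, AT A1's WITNESS: N22's kernel-currency NE9 with fading-memory moduli + the (D4) letter
# `KernelDecayOfRecord₁₃` AS IT STANDS (per-sequence constants) ⟹ ONE-constant (5.10) decay over the window ⟹ the sign-free β-box on the FULL design window `]0, ½]`
# ⟹ `K0V19Defs.AbsBetaBoxAtThm1WitnessCCMGenAt F` BY NAME; hence K0⁷ BY NAME from stub 1's text + the landed stub 2′ + these letters ((j, c)-generic)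

Cell `pub-ymgap`, width seat `pub-ymgap-k0-s3-w1` (g0; director-ym R399 (3a) ∕ №207; HUMAN RULING D-0154; this seat's CLAIM-4).  `--kind proof --supports stmt-QuantumFields-20541 --as helper`,
COUNT-NEUTRAL.  NEW leaf over this seat's `Thm/…K0Stub3RunwiseSuppliers` (p608074 ✓: `absBetaBox_of_kernelDecayWindowUniform`, `record13SepCoPHInhabited_of_stub1_of_kernelDecayWindowUniformAt_byName`)
and W1-19 `Node00/U3OfKernels` (`kernelA`, `EA`, `ne9_EA_iff`, `objectsOfRecord₁₃`, `KernelDecayOfRecord₁₃`, `Window`); nothing modified; theorems only — 0 `def`, 0 `sorry`, no new named fact.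
[I] = [Balaban1987RG1]; [II] = [Balaban1989LargeFieldII]; [III] = [Balaban1988Convergent]; [15] = [Balaban1985Variational]; [6] = [Balaban1985RegularSpaces]; [RG2] = [Balaban1988RG2Cluster].

WHY (LOCATED, for plan ∕ node-O ∕ (D4) desks).  p608074 showed that K0's box socket follows from (5.10)-decay of W1-19's limiting kernels once the constant is UNIFORM over the window, and
noted that the (D4) letter of record `U3OfKernels.KernelDecayOfRecord₁₃ F N θ μ ν κ` (`∀ g ∈ Window θ.γ, ∃ C₀, ∀ k, Decay510 …`) is PER-SEQUENCE.  But the K3 side carries a SECOND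
letter at the same objects — N22's kernel-currency NE9 `NE9 ((objectsOfRecord₁₃ F N θ ℓ).EA 0) (Window θ.γ) κ Λ` («|Π_{k+1}(g; z) − Π_{k+1}(g′; z)| ≤ e^{−κ|z|₁} Σ_{i≤k} Λ (k+1) i |g_i − g′_i|»
for ALL pairs of window sequences) with node-U3 FADING MEMORY `Λ (k+1) i ≤ C₉ ω^{k+1−i}`, `0 ≤ ω < 1` — and that letter TRANSPORTS the (D4) constant of ONE reference sequence
(say the constant sequence `θ.γ`) to EVERY window sequence with a k-UNIFORM surcharge `θ.γ · C₉∕(1 − ω)` (§1: triangle inequality + the geometric row sum).  Hence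
(D4) + NE9(fading) at θ ⟹ one-constant decay over `Window θ.γ` ⟹ (p608074 §3) the sign-free box of `betaOfRecord₁₃ θ` on the FULL window `]0, θ.γ]` (§2), and at A1's witness
(`.γ = ½`) ⟹ 3ᴬ′(F) BY NAME, with NO run letter and NO separate node-O β-estimate (§3): **relative to the K3-side kernel letters RE-KEYED AT THE WITNESS FAMILY, the K0 socket
3ᴬ′ is not an independent debt.**  (Caveat, displayed not hidden: K3⁷'s letters of record are keyed at an INHABITANT θ with provisos, the K0 socket at the bare witness
`θ₁₅ᶜᶜᴹ(j; ε₀, ε₂₉; …)`; the shapes are θ-generic, the keys differ — the same caveat as for every «at the witness» supplier.  NE9 in kernel currency is NOT printed for d = 4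
(W1-19 dictionary); it is the N22 node's output, itself derived in the `T4HistoryLipschitz*` lineage from (1.18)-type uniform analyticity — which is print's own route to
«uniformly bounded», [I] p. 264 ∕ (5.10) p. 293.)

CONTENTS (kernel-checked; CONDITIONAL — NE9, fading memory and (D4) DISPLAYED, inhabited nowhere).
§1 generic W1-19 currency (`F ℰ ρ bV`): `sum_range_succ_moduli_le_of_fadingMemory` (node-U3 `FadingMemory C₉ ω Λ`, `0 ≤ ω < 1` ⟹ `Σ_{i≤k} Λ (k+1) i ≤ C₉∕(1−ω)`),
   ★ `kernelDecayWindowUniform_of_ne9_of_decayAt` (NE9 on `Window γ` with summable non-negative rows + (5.10) at ONE window sequence ⟹ ONE constant `C⋆ + γ·S` for all window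
   sequences and levels).
§2 θ-generic at the record: ★★ `absBetaBox_betaOfRecord₁₃_of_kernelNE9_of_kernelDecay` — `0 < κ`, NE9 (kernel currency, moduli `Λ`), `FadingMemory C₉ ω Λ` (`0 ≤ ω < 1`),
   `KernelDecayOfRecord₁₃ F N θ 0 1 κ`, `0 < θ.γ` ⟹ `∃ β′, BetaLowerH (−β′) θ.γ (betaOfRecord₁₃ θ) ∧ BetaUpperH β′ θ.γ (betaOfRecord₁₃ θ)`.
§3 at A1's witness, (j, c)-generic prefix VERBATIM: ★★★ `abs3A'_of_kernelLettersAt : (∀ j B₃ B₃′ a₀ a₁, ∃ ε₀ ε₂₉ > 0 and letters at θ₁₅ᶜᶜᴹ(j; ε₀, ε₂₉; B₃, B₃′, a₀, a₁)) →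
   K0V19Defs.AbsBetaBoxAtThm1WitnessCCMGenAt F` (window `½`), ★★★ `record13SepCoPHInhabited_of_stub1_of_kernelLettersAt_byName` (K0⁷ BY NAME from V19 stub 1's text, the landed
   stub 2′ inside `K0V19Stub2Prime`, and the letters).

HONEST FRAMING (binding).  Triangle-inequality bookkeeping + by-name composition over landed files; NOTHING of Bałaban's analysis is asserted or proved: kernel-currency NE9 with fading
memory and the (5.10) clause at the record are HYPOTHESES (the K3∕N22∕(D4) desks' letters — inhabited nowhere here); stub 3ᴬ′ is NOT proved (its hypotheses are not discharged); K0⁷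
stmt-QuantumFields-20541 OPEN (V19 87879403b3a26109) and NOT claimed; no registry write; no count claim (typed 28∕28 · discharged 5∕27 unmoved); no summit statement is proved by this
seat; route R4 closes the CONDITIONAL finite-𝕋⁴ rung `BalabanLadder.UV` only — NOTHING about the continuum limit, ℝ⁴, OS axioms, a mass gap or the Clay problem is proved or claimed.
No `sorry`, `def`, `instance`, `notation`, `axiom`; standard axioms.
-/

noncomputable section

open scoped Matrix.Norms.L2Operator BigOperators
open Finset

namespace Summit.QuantumFields.YangMills.Theorems.K0Stub3BoxOfKernelLetters

open Literature.MathematicalPhysics.QuantumFieldTheory.Balaban1983to89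
open Literature.MathematicalPhysics.QuantumFieldTheory.Balaban1983to89.Node00
open Literature.MathematicalPhysics.QuantumFieldTheory.Balaban1983to89.T4Continuum
open Literature.MathematicalPhysics.QuantumFieldTheory.Balaban1983to89.FlowStep
open Literature.MathematicalPhysics.QuantumFieldTheory.Balaban1983to89.T4OutputRate (Window NE9)
open Literature.MathematicalPhysics.QuantumFieldTheory.Balaban1983to89.B12Sec2to5 (l1 Decay510 betaPrime510)
open Literature.MathematicalPhysics.QuantumFieldTheory.Balaban1983to89.Node00.U3OfKernels (kernelA EA ne9_EA_iff objectsOfRecord₁₃ KernelDecayOfRecord₁₃)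
open Summit.QuantumFields.YangMills.Theorems.K0V19Defs (Prop8StepCoPAt AbsBetaBoxAtThm1WitnessCCMGenAt)
open Summit.QuantumFields.YangMills.Theorems.K0V19Stub2Prime (record13SepCoPHInhabited_of_stub1_stub3A'_byName)
open Summit.QuantumFields.YangMills.Theorems.K0Stub3RunwiseSuppliers (absBetaBox_of_kernelDecayWindowUniform)

/-! ## §1  Generic, W1-19 currency: NE9 with summable rows transports (5.10) from ONE window sequence to ALL of them with ONE constant -/

section Generic

/-- **FADING MEMORY ⟹ k-SUMMABLE ROWS (node-U3 indexing)**: `0 ≤ Λ a i ≤ C₉·ω^{a−i}` (`i ≤ a`; `T4OutputRate.FadingMemory C₉ ω Λ`) with `0 ≤ ω < 1` ⟹ for every `k`,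
`Σ_{i ≤ k} Λ (k+1) i ≤ C₉∕(1 − ω)` (each term `≤ C₉ ω^{k+1−i} ≤ C₉ ω^{k−i}`, then the geometric series; `C₉ ≥ 0` is forced). [folklore] -/
theorem sum_range_succ_moduli_le_of_fadingMemory {C₉ ω : ℝ} {Λ : ℕ → ℕ → ℝ} (h : T4OutputRate.FadingMemory C₉ ω Λ) (hω0 : 0 ≤ ω) (hω1 : ω < 1) (k : ℕ) :
    ∑ i ∈ range (k + 1), Λ (k + 1) i ≤ C₉ / (1 - ω) := by
  have hC : 0 ≤ C₉ := by have := h 0 0 le_rfl; simpa using this.1.trans this.2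
  have h1 : ∑ i ∈ range (k + 1), Λ (k + 1) i ≤ ∑ i ∈ range (k + 1), C₉ * ω ^ (k - i) := by
    refine Finset.sum_le_sum fun i hi => ?_
    have hik : i ≤ k := Nat.lt_succ_iff.mp (Finset.mem_range.mp hi)
    have h2 := (h (k + 1) i (by omega)).2
    have h3 : ω ^ (k + 1 - i) ≤ ω ^ (k - i) := by
      rw [show k + 1 - i = (k - i) + 1 by omega, pow_succ]
      exact mul_le_of_le_one_right (pow_nonneg hω0 _) hω1.le
    exact h2.trans (mul_le_mul_of_nonneg_left h3 hC)
  have h2 : ∑ i ∈ range (k + 1), C₉ * ω ^ (k - i) = C₉ * ∑ j ∈ range (k + 1), ω ^ j := by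
    rw [← Finset.mul_sum, ← Finset.sum_range_reflect (fun j => ω ^ j) (k + 1)]
    congr 1
  have h3 : ∑ j ∈ range (k + 1), ω ^ j ≤ 1 / (1 - ω) := by
    have := geom_sum_Ico_le_of_lt_one (m := 0) (n := k + 1) hω0 hω1
    rw [pow_zero, ← Finset.range_eq_Ico] at this
    exact this
  calc ∑ i ∈ range (k + 1), Λ (k + 1) i ≤ C₉ * ∑ j ∈ range (k + 1), ω ^ j := h1.trans_eq h2
    _ ≤ C₉ * (1 / (1 - ω)) := mul_le_mul_of_nonneg_left h3 hC
    _ = C₉ / (1 - ω) := by ring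

variable {𝔄 : Type*} [NormedRing 𝔄] [NormedAlgebra ℝ 𝔄]
variable {V : Type*} [NormedAddCommGroup V] [NormedSpace ℝ V] {ι : Type*} [Fintype ι]
variable (F : T4Family) (ℰ : TermFamily1 F 𝔄) (ρ : V →L[ℝ] 𝔄) (bV : Module.Basis ι ℝ V)

/-- **★ NE9 TRANSPORTS (5.10) FROM ONE WINDOW SEQUENCE TO ALL, WITH ONE CONSTANT**: kernel-currency NE9 on `Window γ` (`γ ≥ 0`) with non-negative rows summing to `≤ S` at every
level, and (5.10)-decay `Decay510 (kernelA … g⋆ k μ ν) C⋆ κ` at ONE window sequence `g⋆` for all `k` ⟹ `Decay510 (kernelA … g k μ ν) (C⋆ + γ·S) κ` for EVERY window sequence `g` and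
every `k` (`|Π(g; z)| ≤ |Π(g⋆; z)| + e^{−κ|z|₁} Σ_i Λ (k+1) i |g_i − g⋆_i|`, and `|g_i − g⋆_i| ≤ γ`).  CONDITIONAL on both letters. [cite: Balaban1987RG1, (5.10) p.293, §5 p.298 and (1.18) p.263 (dictionary: NE9 is NOT printed)] -/
theorem kernelDecayWindowUniform_of_ne9_of_decayAt {γ κ C S : ℝ} {Λ : ℕ → ℕ → ℝ} {μ ν : Fin 4} (hγ : 0 ≤ γ) (h9 : NE9 (EA F ℰ ρ bV) (Window γ) κ Λ)
    (hΛ : ∀ k, ∀ i ∈ range (k + 1), 0 ≤ Λ (k + 1) i) (hS : ∀ k, ∑ i ∈ range (k + 1), Λ (k + 1) i ≤ S)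
    {gs : ℕ → ℝ} (hgs : gs ∈ Window γ) (hdec : ∀ k, Decay510 (kernelA F ℰ ρ bV gs k μ ν) C κ) :
    ∀ g ∈ Window γ, ∀ k : ℕ, Decay510 (kernelA F ℰ ρ bV g k μ ν) (C + γ * S) κ := by
  intro g hg k z
  have hne := (ne9_EA_iff F ℰ ρ bV (Window γ) κ Λ).1 h9 g hg gs hgs k μ ν z
  have hdz := hdec k z
  have hcoord : ∀ i, |g i - gs i| ≤ γ := by
    intro i
    have h1 := hg i
    have h2 := hgs i
    rw [abs_sub_le_iff]
    constructor <;> linarith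
  have hsum : ∑ i ∈ range (k + 1), Λ (k + 1) i * |g i - gs i| ≤ γ * S := by
    calc ∑ i ∈ range (k + 1), Λ (k + 1) i * |g i - gs i| ≤ ∑ i ∈ range (k + 1), Λ (k + 1) i * γ :=
          Finset.sum_le_sum fun i hi => mul_le_mul_of_nonneg_left (hcoord i) (hΛ k i hi)
      _ = γ * ∑ i ∈ range (k + 1), Λ (k + 1) i := by rw [Finset.mul_sum]; exact Finset.sum_congr rfl fun i _ => mul_comm _ _
      _ ≤ γ * S := mul_le_mul_of_nonneg_left (hS k) hγ
  have hexp : 0 ≤ Real.exp (-(κ * l1 z)) := Real.exp_nonneg _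
  have htri : |kernelA F ℰ ρ bV g k μ ν z| ≤ |kernelA F ℰ ρ bV gs k μ ν z| + |kernelA F ℰ ρ bV g k μ ν z - kernelA F ℰ ρ bV gs k μ ν z| := by
    have := abs_add_le (kernelA F ℰ ρ bV gs k μ ν z) (kernelA F ℰ ρ bV g k μ ν z - kernelA F ℰ ρ bV gs k μ ν z)
    rwa [add_sub_cancel] at this
  have hrhs : Real.exp (-(κ * l1 z)) * ∑ i ∈ range (k + 1), Λ (k + 1) i * |g i - gs i| ≤ Real.exp (-κ * l1 z) * (γ * S) := by
    rw [neg_mul]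
    exact mul_le_mul_of_nonneg_left hsum hexp
  calc |kernelA F ℰ ρ bV g k μ ν z| ≤ C * Real.exp (-κ * l1 z) + Real.exp (-κ * l1 z) * (γ * S) := by linarith
    _ = (C + γ * S) * Real.exp (-κ * l1 z) := by ring

end Generic

/-! ## §2  θ-generic at the record: N22's kernel NE9 (fading memory) + the (D4) letter AS IT STANDS ⟹ the sign-free box of `betaOfRecord₁₃ θ` on the FULL window `]0, θ.γ]` -/

section Record

variable (F : T4Family) (N : ℕ) [NeZero N]

/-- **★★ THE SIGN-FREE β-BOX OF THE RECORD FROM THE K3-SIDE KERNEL LETTERS ALONE** (any `θ : Stage13Params F N` with `0 < θ.γ`): `0 < κ`, N22's kernel-currency NE9 of the functional of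
record `(objectsOfRecord₁₃ F N θ ℓ).EA 0` on `Window θ.γ` with moduli `Λ` of node-U3 fading memory `FadingMemory C₉ ω Λ` (`0 ≤ ω < 1`), and the (D4) letter of record
`KernelDecayOfRecord₁₃ F N θ 0 1 κ` (per-sequence constants — read at the ONE constant sequence `θ.γ`) ⟹ `∃ β′, −β′ ≤ β₁₃(θ) ≤ β′` on every box `]0, θ.γ]^{k+1}`
(`β′ = β′₅₁₀(C⋆ + θ.γ·C₉∕(1−ω), κ)`): §1 makes the decay constant uniform over the window, p608074's `absBetaBox_of_kernelDecayWindowUniform` reads it off as the box.  CONDITIONAL on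
the three letters; NO run letter, NO separate β-estimate; nothing of Bałaban asserted. [cite: Balaban1987RG1, (1.20)–(1.22) p.264, §1 p.264 («uniformly bounded»), (5.10) p.293, (5.42) p.297; Balaban1988RG2Cluster, (2.13)–(2.14) pp.14–15] -/
theorem absBetaBox_betaOfRecord₁₃_of_kernelNE9_of_kernelDecay (θ : Stage13Params F N) (ℓ : U3Letters₁₁) {κ C₉ ω : ℝ} {Λ : ℕ → ℕ → ℝ} (hκ : 0 < κ) (hγ : 0 < θ.γ)
    (h9 : NE9 ((objectsOfRecord₁₃ F N θ ℓ).EA 0) (Window θ.γ) κ Λ) (hΛ : T4OutputRate.FadingMemory C₉ ω Λ) (hω0 : 0 ≤ ω) (hω1 : ω < 1)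
    (hdec : KernelDecayOfRecord₁₃ F N θ 0 1 κ) :
    ∃ β' : ℝ, BetaLowerH (-β') θ.γ (betaOfRecord₁₃ F N θ) ∧ BetaUpperH β' θ.γ (betaOfRecord₁₃ F N θ) := by
  letI := θ.instVβ₁; letI := θ.instVβ₂; letI := θ.instιβ
  -- the constant sequence `θ.γ` lies in the window (the tree's `mem_window_const` pattern, inlined)
  have hconst : (fun _ : ℕ => θ.γ) ∈ Window θ.γ := fun _ => ⟨hγ, le_rfl⟩
  obtain ⟨C, hC⟩ := hdec (fun _ => θ.γ) hconst
  have hunif := kernelDecayWindowUniform_of_ne9_of_decayAt F _ θ.ρ8 θ.bV (μ := 0) (ν := 1) hγ.le h9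
    (fun k i hi => (hΛ (k + 1) i (by have := Finset.mem_range.mp hi; omega)).1) (sum_range_succ_moduli_le_of_fadingMemory hΛ hω0 hω1)
    hconst hC
  exact ⟨_, absBetaBox_of_kernelDecayWindowUniform F N θ hκ le_rfl hunif⟩

end Record

/-! ## §3  At A1's collared witness `θ₁₅ᶜᶜᴹ(j)` (`.γ = ½`), (j, c)-generic: the letters at the witness family ⟹ 3ᴬ′(F) BY NAME ⟹ K0⁷ BY NAME with stub 1's text and the landed stub 2′ -/

section Witness

/-- **★★★ V19's REGISTERED SOCKET TEXT 3ᴬ′(F) FROM THE K3∕N22 KERNEL LETTERS AT THE WITNESS FAMILY** — for every cube letter index `j` and constants `(B₃, B₃′, a₀, a₁)` SOME thresholds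
`ε₀, ε₂₉ > 0`, a letter block `ℓ`, a rate `κ > 0`, moduli `Λ` with node-U3 fading memory `(C₉, ω)`, `0 ≤ ω < 1`, carrying N22's kernel NE9 on `Window ½` and the (D4) letter
`KernelDecayOfRecord₁₃ … 0 1 κ` at `θ₁₅ᶜᶜᴹ(j; ε₀, ε₂₉; B₃, B₃′, a₀, a₁)` ⟹ `K0V19Defs.AbsBetaBoxAtThm1WitnessCCMGenAt F`, with the FULL design window `γ₀ = ½` (the (8)∕(9) guards of the
prefix are not read).  CONDITIONAL on the letters (inhabited nowhere here); stub 3ᴬ′ NOT proved; K0⁷ OPEN. [cite: Balaban1987RG1, Thm 1 p.259, (1.20)–(1.22) p.264, §1 p.264, (5.10) p.293; Balaban1985Variational, Thm 1 p.279, Prop. 8 p.304; Balaban1988Convergent, Thm 1 p.262] -/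
theorem abs3A'_of_kernelLettersAt (F : T4Family)
    (hK : ∀ (j : ℕ) (B₃ B₃' a₀ a₁ : ℝ), ∃ ε₀ ε₂₉ : ℝ, 0 < ε₀ ∧ 0 < ε₂₉ ∧
      ∃ (ℓ : U3Letters₁₁) (κ C₉ ω : ℝ) (Λ : ℕ → ℕ → ℝ), 0 < κ ∧ 0 ≤ ω ∧ ω < 1 ∧
        NE9 ((objectsOfRecord₁₃ F 2 (theta13OfThm1CCM F 2 j ε₀ ε₂₉ B₃ B₃' a₀ a₁) ℓ).EA 0) (Window (theta13OfThm1CCM F 2 j ε₀ ε₂₉ B₃ B₃' a₀ a₁).γ) κ Λ ∧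
        T4OutputRate.FadingMemory C₉ ω Λ ∧
        KernelDecayOfRecord₁₃ F 2 (theta13OfThm1CCM F 2 j ε₀ ε₂₉ B₃ B₃' a₀ a₁) 0 1 κ) :
    AbsBetaBoxAtThm1WitnessCCMGenAt F := by
  intro j c B₃ B₃' a₀ a₁ _ _ _ _ _ _ _
  obtain ⟨ε₀, ε₂₉, hε, hε', ℓ, κ, C₉, ω, Λ, hκ, hω0, hω1, h9, hΛ, hdec⟩ := hK j B₃ B₃' a₀ a₁
  have hγ : 0 < (theta13OfThm1CCM F 2 j ε₀ ε₂₉ B₃ B₃' a₀ a₁).γ := by rw [theta13OfThm1CCM_γ]; norm_num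
  obtain ⟨β', hlow, hup⟩ := absBetaBox_betaOfRecord₁₃_of_kernelNE9_of_kernelDecay F 2 _ ℓ hκ hγ h9 hΛ hω0 hω1 hdec
  rw [theta13OfThm1CCM_γ] at hlow hup
  exact ⟨1 / 2, ε₀, ε₂₉, β', by norm_num, hε, hε', hlow, hup⟩

/-- **★★★ K0⁷ BY NAME FROM V19 STUB 1's TEXT, THE LANDED STUB 2′ AND THE K3∕N22 KERNEL LETTERS AT THE WITNESS FAMILY** — `h1 : ∀ F, K0V19Defs.Prop8StepCoPAt F` (registered stub 1's
text, NOT proved here); `hK` = §3's letters at every family (NOT inhabited here); stub 2′ BY NAME inside `K0V19Stub2Prime.record13SepCoPHInhabited_of_stub1_stub3A'_byName` (p595104 ✓);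
the crux decl `Summit.QuantumFields.YangMills.Theses.BalabanUVNodes.Record13SepCoPHInhabited` concluded BY NAME via 3ᴬ′.  CONDITIONAL; K0⁷ OPEN; a helper, not a closer; no β-estimate of
node O is used or claimed beyond the displayed letters. [cite: Balaban1985Variational, Thm 1 (8)–(9) p.279, Prop. 8 p.304; Balaban1985RegularSpaces, Prop. 6 p.99, p.98; Balaban1988Convergent, Thm 1 p.262, (2.6)–(2.8) pp.255–256; Balaban1987RG1, Thm 1 p.259, §1 p.264, (5.10) p.293] -/
theorem record13SepCoPHInhabited_of_stub1_of_kernelLettersAt_byName (h1 : ∀ F : T4Family, Prop8StepCoPAt F)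
    (hK : ∀ (F : T4Family) (j : ℕ) (B₃ B₃' a₀ a₁ : ℝ), ∃ ε₀ ε₂₉ : ℝ, 0 < ε₀ ∧ 0 < ε₂₉ ∧
      ∃ (ℓ : U3Letters₁₁) (κ C₉ ω : ℝ) (Λ : ℕ → ℕ → ℝ), 0 < κ ∧ 0 ≤ ω ∧ ω < 1 ∧
        NE9 ((objectsOfRecord₁₃ F 2 (theta13OfThm1CCM F 2 j ε₀ ε₂₉ B₃ B₃' a₀ a₁) ℓ).EA 0) (Window (theta13OfThm1CCM F 2 j ε₀ ε₂₉ B₃ B₃' a₀ a₁).γ) κ Λ ∧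
        T4OutputRate.FadingMemory C₉ ω Λ ∧
        KernelDecayOfRecord₁₃ F 2 (theta13OfThm1CCM F 2 j ε₀ ε₂₉ B₃ B₃' a₀ a₁) 0 1 κ) :
    Summit.QuantumFields.YangMills.Theses.BalabanUVNodes.Record13SepCoPHInhabited :=
  record13SepCoPHInhabited_of_stub1_stub3A'_byName h1 fun F => abs3A'_of_kernelLettersAt F (hK F)

end Witness

/-! ## §4  (v1.1, append-only) From EXACTLY W1's three letters of record — `PolLimitsExistOfRecord₁₃`, `WindowedNE9OfRecord₁₃` (fading memory), `WindowedDecayOfRecord₁₃` — as the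
Summit-side kernel producers display them (finite volume, eventually in `K`): the estimate-free (1.21) passages BY NAME (n22's `ne9_EA_of_windowed`, n22-w3's
`kernelDecayOfRecord₁₃_of_windowed`) then §2 ∕ §3; and the SMALL-WINDOW edition at `θ₁₅ᶜᶜᴹᵂ(j; γ₀)`, `γ₀ ≤ ½`, transferred to A1's witness BY NAME -/

section W1Letters

open Literature.MathematicalPhysics.QuantumFieldTheory.Balaban1983to89.Node00.U3KernelLetters (PolLimitsExistOfRecord₁₃ WindowedNE9OfRecord₁₃ WindowedDecayOfRecord₁₃)
open YMDAG.N22.AtKernels (ne9_EA_of_windowed kernelDecayOfRecord₁₃_of_windowed)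

variable (F : T4Family) (N : ℕ) [NeZero N]

/-- **★★ THE SIGN-FREE β-BOX OF THE RECORD FROM W1's THREE LETTERS OF RECORD** (any `θ`, `0 < θ.γ`, `0 < κ`): the (1.21) existence letter `PolLimitsExistOfRecord₁₃ F N θ`, the
windowed NE9 letter `WindowedNE9OfRecord₁₃ F N θ κ Λ` with node-U3 fading memory `FadingMemory C₉ ω Λ` (`0 ≤ ω < 1`), and the windowed (5.10) letter `WindowedDecayOfRecord₁₃ F N θ 0 1 κ`
(per-sequence constants, eventually in `K`) ⟹ `∃ β′, −β′ ≤ β₁₃(θ) ≤ β′` on `]0, θ.γ]^{k+1}`, all `k`.  The limits inherit NE9 and (5.10) (`le_of_tendsto`, by name), then §2.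
CONDITIONAL on the four displayed letters; nothing of Bałaban asserted. [cite: Balaban1987RG1, (1.21)–(1.22) p.264, §1 p.264, (1.18) p.263, (5.10) p.293] -/
theorem absBetaBox_betaOfRecord₁₃_of_W1Letters (θ : Stage13Params F N) {κ C₉ ω : ℝ} {Λ : ℕ → ℕ → ℝ} (hκ : 0 < κ) (hγ : 0 < θ.γ)
    (hlim : PolLimitsExistOfRecord₁₃ F N θ) (h9w : WindowedNE9OfRecord₁₃ F N θ κ Λ) (hΛ : T4OutputRate.FadingMemory C₉ ω Λ) (hω0 : 0 ≤ ω) (hω1 : ω < 1)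
    (hdecw : WindowedDecayOfRecord₁₃ F N θ 0 1 κ) :
    ∃ β' : ℝ, BetaLowerH (-β') θ.γ (betaOfRecord₁₃ F N θ) ∧ BetaUpperH β' θ.γ (betaOfRecord₁₃ F N θ) := by
  letI := θ.instVβ₁; letI := θ.instVβ₂; letI := θ.instιβ
  -- the level carriers of `objectsOfRecord₁₃` take a letter block; its run-A functional `.EA 0` does not read it, so any block serves to phrase NE9
  let ℓ : U3Letters₁₁ := ⟨κ, 0, 0, C₉, ω, 0, 0⟩
  have h9 : NE9 ((objectsOfRecord₁₃ F N θ ℓ).EA 0) (Window θ.γ) κ Λ := ne9_EA_of_windowed F _ θ.ρ8 θ.bV hlim h9w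
  have hdec : KernelDecayOfRecord₁₃ F N θ 0 1 κ := kernelDecayOfRecord₁₃_of_windowed F N θ 0 1 κ hlim hdecw
  exact absBetaBox_betaOfRecord₁₃_of_kernelNE9_of_kernelDecay F N θ ℓ hκ hγ h9 hΛ hω0 hω1 hdec

/-- **★★★ V19's SOCKET TEXT 3ᴬ′(F) FROM W1's THREE LETTERS OF RECORD AT THE WITNESS FAMILY** (some thresholds `ε₀, ε₂₉ > 0` per `(j, B₃, B₃′, a₀, a₁)`; window `γ₀ = ½`).  CONDITIONAL on
the letters (inhabited nowhere here); stub 3ᴬ′ NOT proved; K0⁷ OPEN. [cite: Balaban1987RG1, Thm 1 p.259, (1.21)–(1.22) p.264, §1 p.264, (5.10) p.293; Balaban1985Variational, Thm 1 p.279, Prop. 8 p.304; Balaban1988Convergent, Thm 1 p.262] -/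
theorem abs3A'_of_W1LettersAt (F : T4Family)
    (hK : ∀ (j : ℕ) (B₃ B₃' a₀ a₁ : ℝ), ∃ ε₀ ε₂₉ : ℝ, 0 < ε₀ ∧ 0 < ε₂₉ ∧
      ∃ (κ C₉ ω : ℝ) (Λ : ℕ → ℕ → ℝ), 0 < κ ∧ 0 ≤ ω ∧ ω < 1 ∧
        PolLimitsExistOfRecord₁₃ F 2 (theta13OfThm1CCM F 2 j ε₀ ε₂₉ B₃ B₃' a₀ a₁) ∧
        WindowedNE9OfRecord₁₃ F 2 (theta13OfThm1CCM F 2 j ε₀ ε₂₉ B₃ B₃' a₀ a₁) κ Λ ∧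
        T4OutputRate.FadingMemory C₉ ω Λ ∧
        WindowedDecayOfRecord₁₃ F 2 (theta13OfThm1CCM F 2 j ε₀ ε₂₉ B₃ B₃' a₀ a₁) 0 1 κ) :
    AbsBetaBoxAtThm1WitnessCCMGenAt F := by
  intro j c B₃ B₃' a₀ a₁ _ _ _ _ _ _ _
  obtain ⟨ε₀, ε₂₉, hε, hε', κ, C₉, ω, Λ, hκ, hω0, hω1, hlim, h9w, hΛ, hdecw⟩ := hK j B₃ B₃' a₀ a₁
  have hγ : 0 < (theta13OfThm1CCM F 2 j ε₀ ε₂₉ B₃ B₃' a₀ a₁).γ := by rw [theta13OfThm1CCM_γ]; norm_num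
  obtain ⟨β', hlow, hup⟩ := absBetaBox_betaOfRecord₁₃_of_W1Letters F 2 _ hκ hγ hlim h9w hΛ hω0 hω1 hdecw
  rw [theta13OfThm1CCM_γ] at hlow hup
  exact ⟨1 / 2, ε₀, ε₂₉, β', by norm_num, hε, hε', hlow, hup⟩

/-- **★★★ K0⁷ BY NAME FROM V19 STUB 1's TEXT, THE LANDED STUB 2′ AND W1's THREE LETTERS OF RECORD AT THE WITNESS FAMILY** (stub 2′ BY NAME inside `K0V19Stub2Prime`, p595104).
CONDITIONAL on `h1` (stub 1's text) and `hK` (the letters); K0⁷ OPEN; a helper, not a closer. [cite: Balaban1985Variational, Thm 1 (8)–(9) p.279, Prop. 8 p.304; Balaban1985RegularSpaces, Prop. 6 p.99, p.98; Balaban1988Convergent, Thm 1 p.262; Balaban1987RG1, Thm 1 p.259, (1.21)–(1.22) p.264, §1 p.264, (5.10) p.293] -/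
theorem record13SepCoPHInhabited_of_stub1_of_W1LettersAt_byName (h1 : ∀ F : T4Family, Prop8StepCoPAt F)
    (hK : ∀ (F : T4Family) (j : ℕ) (B₃ B₃' a₀ a₁ : ℝ), ∃ ε₀ ε₂₉ : ℝ, 0 < ε₀ ∧ 0 < ε₂₉ ∧
      ∃ (κ C₉ ω : ℝ) (Λ : ℕ → ℕ → ℝ), 0 < κ ∧ 0 ≤ ω ∧ ω < 1 ∧
        PolLimitsExistOfRecord₁₃ F 2 (theta13OfThm1CCM F 2 j ε₀ ε₂₉ B₃ B₃' a₀ a₁) ∧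
        WindowedNE9OfRecord₁₃ F 2 (theta13OfThm1CCM F 2 j ε₀ ε₂₉ B₃ B₃' a₀ a₁) κ Λ ∧
        T4OutputRate.FadingMemory C₉ ω Λ ∧
        WindowedDecayOfRecord₁₃ F 2 (theta13OfThm1CCM F 2 j ε₀ ε₂₉ B₃ B₃' a₀ a₁) 0 1 κ) :
    Summit.QuantumFields.YangMills.Theses.BalabanUVNodes.Record13SepCoPHInhabited :=
  record13SepCoPHInhabited_of_stub1_stub3A'_byName h1 fun F => abs3A'_of_W1LettersAt F (hK F)


/-- **★★★ THE SMALL-WINDOW EDITION (what node O can plausibly deliver): W1's THREE LETTERS AT THE WINDOW WITNESS `θ₁₅ᶜᶜᴹᵂ(j; γ₀)` FOR SOME `γ₀ ∈ ]0, ½]` ⟹ 3ᴬ′(F).**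
The letters of record are pinned to the design window `Window θ.γ`; at A1's witness that is `Window ½` — large for a coupling.  A2ʷ's window edition
`theta13OfThm1CCMW F 2 j γ₀ ε₀ ε₂₉ …` (`.γ = γ₀`) carries the SAME β as A1's witness on `]0, γ₀]^{k+1}` (dag-n21-c∕A2ʷ `betaOfRecord₁₃_theta13OfThm1CCMW_eq_of_mem`), so the letters need
hold only on `Window γ₀`: §4's box at the window edition, then `betaLowerH_half_of_theta13OfThm1CCMW` ∕ `betaUpperH_half_of_theta13OfThm1CCMW` BY NAME, give V19's socket text with that
`γ₀`.  CONDITIONAL on the letters (inhabited nowhere here); stub 3ᴬ′ NOT proved. [cite: Balaban1987RG1, Thm 1 p.259, (1.20)–(1.22) p.264, §1 p.264, (5.10) p.293; Balaban1985Variational, Thm 1 p.279, Prop. 8 p.304; Balaban1988Convergent, Thm 1 p.262] -/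
theorem abs3A'_of_W1LettersAtWindowEdition (F : T4Family)
    (hK : ∀ (j : ℕ) (B₃ B₃' a₀ a₁ : ℝ), ∃ γ₀ ε₀ ε₂₉ : ℝ, 0 < γ₀ ∧ γ₀ ≤ 1 / 2 ∧ 0 < ε₀ ∧ 0 < ε₂₉ ∧
      ∃ (κ C₉ ω : ℝ) (Λ : ℕ → ℕ → ℝ), 0 < κ ∧ 0 ≤ ω ∧ ω < 1 ∧
        PolLimitsExistOfRecord₁₃ F 2 (theta13OfThm1CCMW F 2 j γ₀ ε₀ ε₂₉ B₃ B₃' a₀ a₁) ∧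
        WindowedNE9OfRecord₁₃ F 2 (theta13OfThm1CCMW F 2 j γ₀ ε₀ ε₂₉ B₃ B₃' a₀ a₁) κ Λ ∧
        T4OutputRate.FadingMemory C₉ ω Λ ∧
        WindowedDecayOfRecord₁₃ F 2 (theta13OfThm1CCMW F 2 j γ₀ ε₀ ε₂₉ B₃ B₃' a₀ a₁) 0 1 κ) :
    AbsBetaBoxAtThm1WitnessCCMGenAt F := by
  intro j c B₃ B₃' a₀ a₁ _ _ _ _ _ _ _
  obtain ⟨γ₀, ε₀, ε₂₉, hγ₀, hγhalf, hε, hε', κ, C₉, ω, Λ, hκ, hω0, hω1, hlim, h9w, hΛ, hdecw⟩ := hK j B₃ B₃' a₀ a₁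
  have hγ : 0 < (theta13OfThm1CCMW F 2 j γ₀ ε₀ ε₂₉ B₃ B₃' a₀ a₁).γ := by rw [theta13OfThm1CCMW_γ]; exact hγ₀
  obtain ⟨β', hlow, hup⟩ := absBetaBox_betaOfRecord₁₃_of_W1Letters F 2 _ hκ hγ hlim h9w hΛ hω0 hω1 hdecw
  rw [theta13OfThm1CCMW_γ] at hlow hup
  exact ⟨γ₀, ε₀, ε₂₉, β', hγ₀, hε, hε', betaLowerH_half_of_theta13OfThm1CCMW hγhalf hlow, betaUpperH_half_of_theta13OfThm1CCMW hγhalf hup⟩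

/-- **★★★ K0⁷ BY NAME FROM V19 STUB 1's TEXT, THE LANDED STUB 2′ AND W1's THREE LETTERS AT THE SMALL-WINDOW WITNESS EDITION** (some `γ₀ ∈ ]0, ½]`, thresholds `ε₀, ε₂₉ > 0` per
`(j, B₃, B₃′, a₀, a₁)`; stub 2′ BY NAME inside `K0V19Stub2Prime`, p595104) — the end-to-end statement a node-O ∕ K3-side supplier at a SMALL coupling window meets.  CONDITIONAL on `h1`
and the letters; K0⁷ OPEN; a helper, not a closer. [cite: Balaban1985Variational, Thm 1 (8)–(9) p.279, Prop. 8 p.304; Balaban1985RegularSpaces, Prop. 6 p.99, p.98; Balaban1988Convergent, Thm 1 p.262; Balaban1987RG1, Thm 1 p.259, (1.21)–(1.22) p.264, §1 p.264, (5.10) p.293] -/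
theorem record13SepCoPHInhabited_of_stub1_of_W1LettersAtWindowEdition_byName (h1 : ∀ F : T4Family, Prop8StepCoPAt F)
    (hK : ∀ (F : T4Family) (j : ℕ) (B₃ B₃' a₀ a₁ : ℝ), ∃ γ₀ ε₀ ε₂₉ : ℝ, 0 < γ₀ ∧ γ₀ ≤ 1 / 2 ∧ 0 < ε₀ ∧ 0 < ε₂₉ ∧
      ∃ (κ C₉ ω : ℝ) (Λ : ℕ → ℕ → ℝ), 0 < κ ∧ 0 ≤ ω ∧ ω < 1 ∧
        PolLimitsExistOfRecord₁₃ F 2 (theta13OfThm1CCMW F 2 j γ₀ ε₀ ε₂₉ B₃ B₃' a₀ a₁) ∧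
        WindowedNE9OfRecord₁₃ F 2 (theta13OfThm1CCMW F 2 j γ₀ ε₀ ε₂₉ B₃ B₃' a₀ a₁) κ Λ ∧
        T4OutputRate.FadingMemory C₉ ω Λ ∧
        WindowedDecayOfRecord₁₃ F 2 (theta13OfThm1CCMW F 2 j γ₀ ε₀ ε₂₉ B₃ B₃' a₀ a₁) 0 1 κ) :
    Summit.QuantumFields.YangMills.Theses.BalabanUVNodes.Record13SepCoPHInhabited :=
  record13SepCoPHInhabited_of_stub1_stub3A'_byName h1 fun F => abs3A'_of_W1LettersAtWindowEdition F (hK F)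

end W1Letters

end Summit.QuantumFields.YangMills.Theorems.K0Stub3BoxOfKernelLetters

end
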